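/-
Copyright (c) 2026 the pub-hodgecm-mathlib formalisation cell (harness21).  Prover seat hodgecm-mathlib-K2E1-p13 (g2), Track B ∕ K2-LIT, h413 = `stmt-HodgeConjecture-24833`,
line `K2_E1_TraceFormulaBeta`, campaign «EIS-RANK-ONE» ∕ R8-LADDER-2, deal (125) T2′ FILE F2 (dealer K2E1-plan (g6)∕(g7), plan of record K2E1-p13 (g0)
`K2/K2E1-p13/g0/HANDOFF-g0-to-g1.K2E1-p13-g0.md` §2): THE FUNCTIONAL EQUATION `c̃(z)·c̃(1 − z) = 1` of the scattering coefficient of the spherical Eisenstein series of `U(1,1)_{L∕L⁺}`.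
-/
import Summits.HodgeConjecture.HodgeConjecture.Theorems.K2E1SphericalEisensteinMeromorphicExportsU2Bounds   -- ★ X2b p859696: THE export head `sphericalEisenstein_meromorphic_exports_cm_two` (brings ★ X2 core, ★ X2a, ★ X1)
import Summits.HodgeConjecture.HodgeConjecture.Theorems.K2E1SphericalEisensteinMeromorphicExportsU2Unique   -- ★ F1 p859728: the per-ball package WITH the B–L uniqueness clause `exists_ball_package_unique_cm_two`
import Summits.HodgeConjecture.HodgeConjecture.Theorems.K2E1SphericalTransformSymmetryU                     -- ★ p859498 (G1): `sphericalTransform_symm_cm_two` (`ĥ(z) = ĥ(1 − z)`)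
import Summits.HodgeConjecture.HodgeConjecture.Theorems.K2E1ConvexDiffCountableConnected                     -- ★ p859595: `isPreconnected_convex_diff_of_countable`, `countable_of_codiscrete`
import HarnessLib

/-!
# R8₂-sph ROAD T′, T2′ FILE F2 — `K2E1ScatteringFunctionalEquationCMTwo`: THE FUNCTIONAL EQUATION `c̃(z)·c̃(1 − z) = 1` OF THE SPHERICAL SCATTERING COEFFICIENT OF `U(1,1)_{L∕L⁺}`

Track B ∕ K2-LIT, crux h413 = `stmt-HodgeConjecture-24833`, route of record `HCCMUnconditional`; cell `hodgecm-mathlib`, squad K2, ENGINE E1.  THEOREMS ONLY (no `def`, no `instance`,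
no `notation`, no `sorry`; default heartbeats); lane `--supports stmt-HodgeConjecture-24833 --as helper` (count-neutral).

WHAT.  ★ X2b `sphericalEisenstein_meromorphic_exports_cm_two` exports the meromorphically continued spherical Eisenstein series `Ec` of `U(1,1)_{L∕L⁺}` with its pole set `P`
(closed, co-discrete, `⊆ {Re ≤ 1}`) and the constant-term coefficient `c̃ = cI` (analytic off `P`, `= c(z) = ν(𝓕)⁻¹∫_{N(𝔸)} H(w₀v)^z dν` on `{1 < Re}`,
`E_B(Ec z) = φ₀·(H^z + c̃(z)·H^{1−z})` there).  THIS FILE adds the functional equation **(FE) `c̃(z)·c̃(1 − z) = 1` for all `z ∉ P`, `1 − z ∉ P`** — the letter `hFE` of ★ T2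
`K2E1ScatteringUnitaryAxisCMTwo.norm_eq_one_on_axis_of_fe` (`‖c̃(½ + it)‖ = 1`) and of the Maass–Selberg road — by the Bernstein–Lapid UNIQUENESS argument [BernsteinLapid2019, §5]:
* §1 **`coeff_eq_mul_of_package`** (per-ball identification, reusable by the operator road): for ANY per-ball package of ★ X1∕★ F1 (holomorphy set `U ⊆ D_n`, co-discrete; vector
  solution `vX` with the Godement agreement `vX(z) = [E(φ₀H^z)]` on `U ∩ {1 < Re}`; coefficient `cc` holomorphic on `U`; the `α`-system `cnst_N(ι vX(z)) = φ₀•α₁(z) + cc(z)•α₂(z)`,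
  `α₁ = [H^z]`, `α₂ = [H^{1−z}] ≠ 0`) and ANY `(P, c̃)` with X2's clauses: **`cc(z) = φ₀·c̃(z)` on `U ∖ P`**.  On the Godement part ★ X2a (S2) identified
  `cnst_N(ι[E(φ₀H^z)]) = φ₀•[H^z] + (φ₀c(z))•[H^{1−z}]` and `α₂ ≠ 0` give `cc = φ₀·c = φ₀·c̃`; then the identity theorem on `U ∖ P = D_n ∖ ((D_n ∖ U) ∪ P)` (open convex minus
  countable ⇒ preconnected, ★ `isPreconnected_convex_diff_of_countable`; co-discrete sets are countable, `ℂ` hereditarily Lindelöf).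
* §2 **`coeff_mul_coeff_one_sub_eq_one_of_unique`** (per-ball FE from UNIQUENESS, `φ₀ = 1`): for `z, 1 − z ∈ U`, `v′ := vX(1 − z)` satisfies the `𝔛_z`-eigen-equations
  (`ĥ_i(1 − z) = ĥ_i(z)`, ★ (G1) `sphericalTransform_symm_cm_two`) with `cnst_N(ι v′) = α₂(z) + cc(1−z)•α₁(z)` (`α₁(1−z) = α₂(z)`, `α₂(1−z) = α₁(z)` in `𝓗_k(Z_a)`); if
  `cc(1−z) = 0` then `vX(z) + v′` solves the system with `b = cc(z) + 1`, so uniqueness forces `v′ = 0`, whence `α₂(z) = 0` ✗; otherwise `cc(1−z)⁻¹•v′` solves it with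
  `b = cc(1−z)⁻¹`, so uniqueness gives `cc(1−z)⁻¹ = cc(z)`: **`cc(z)·cc(1 − z) = 1`**.
* §3 HEAD **`sphericalEisenstein_meromorphic_exports_fe_cm_two`** = ★ X2b's conclusion VERBATIM with, after (E3), the clause (FE) on the SAME `P`, `cI`: §1 at `φ₀ = 1` on ★ F1's
  package (ball `D₀ = ball 0 2 ∋ ½`) makes `c̃(z)c̃(1−z) = 1` near a point `z₀` with `z₀, 1 − z₀ ∈ U ∖ P` (co-discreteness at `½`, pulled back along `s ↦ 1 − s`); `z ↦ c̃(z)c̃(1−z)`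
  is analytic on `Ω = {z ∉ P, 1 − z ∉ P} = ℂ ∖ (P ∪ (1 − P))` (preconnected: countable complement), so (FE) holds on `Ω` (Mathlib `AnalyticOnNhd.eqOn_of_preconnected_of_eventuallyEq`).
HONEST LABEL: HC_CM is proved only modulo the 7 printed citations (2 remaining named inputs: hLiu418 = `stmt-HodgeConjecture-24832`, h413 = `stmt-HodgeConjecture-24833`) until rung 0
closes; this file asserts no named fact, closes no socket; count-neutral; letter-free (structural measure data only, as ★ X2b).
[cite: BernsteinLapid2019, Thm 2.3, §4 Claims 3–5 (pp. 9–10) and §5] [cite: MoeglinWaldspurger1995, IV.1.10–IV.1.11] [cite: Langlands1976, §7]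

## References
* [BernsteinLapid2019] J. Bernstein, E. Lapid, *On the meromorphic continuation of Eisenstein series*, J. AMS 37 (2024), Thm 2.3, §4, §5 (functional equations from uniqueness).
* [MoeglinWaldspurger1995] C. Mœglin, J.-L. Waldspurger, *Spectral decomposition and Eisenstein series* (1995), IV.1.10–IV.1.11 (functional equation of the intertwining operators).
* [Langlands1976] R. P. Langlands, *On the Functional Equations Satisfied by Eisenstein Series*, LNM 544 (1976), §7.
-/

set_option autoImplicit false
set_option linter.dupNamespace false  -- the mandated namespace repeats the summit's segment (`HodgeConjecture.HodgeConjecture`)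

noncomputable section

open MeasureTheory Filter Topology Set NumberField
open scoped NNReal ENNReal Classical ComplexConjugate
open Literature.MeasureTheory.Group Literature.NumberTheory Literature.NumberTheory.Automorphic Literature.NumberTheory.Automorphic.UnitaryGroup AdelicGroupData
open Summit.HodgeConjecture.HodgeConjecture.Cruxes.H413.K2E1BorelEisensteinU
open Summit.HodgeConjecture.HodgeConjecture.Cruxes.H413.K2E1BLBorelSpacesU2Defs
open Summit.HodgeConjecture.HodgeConjecture.Cruxes.H413.K2E1BLBorelOperatorsU2Defs
open Summit.HodgeConjecture.HodgeConjecture.Cruxes.H413.K2E1BLIotaClosedEmbeddingU2 (isFiniteMeasure_weightedTruncMeasure_cm)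
open Summit.HodgeConjecture.HodgeConjecture.Cruxes.H413.K2E1BLEisensteinMemHXCMTwo (eisensteinSeriesU_flatSectionU_memHX_cm_two)
open Summit.HodgeConjecture.HodgeConjecture.Cruxes.H413.K2E1BLFibreAverageInvarianceU (integral_zFun_borelConstantTerm_eq_of_unfolding)
open Summit.HodgeConjecture.HodgeConjecture.Cruxes.H413.K2E1IntertwinedSectionInvariance (map_conj_toAdelic_eq_self_two)
open Summit.HodgeConjecture.HodgeConjecture.Cruxes.H413.K2E1SphericalEisensteinCoefficientCMTwo (cnstN_iota_toHX_eisensteinSeriesU_eq_smul_add_cm_two)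
open Summit.HodgeConjecture.HodgeConjecture.Cruxes.H413.K2E1SphericalEisensteinMeromorphicExportsU2Bounds (sphericalEisenstein_meromorphic_exports_cm_two)
open Summit.HodgeConjecture.HodgeConjecture.Cruxes.H413.K2E1SphericalEisensteinMeromorphicExportsU2Unique (exists_ball_package_unique_cm_two)
open Summit.HodgeConjecture.HodgeConjecture.Cruxes.H413.K2E1SphericalTransformSymmetryU (sphericalTransform_symm_cm_two)
open Summit.HodgeConjecture.HodgeConjecture.Cruxes.H413.K2E1ConvexDiffCountableConnected (isPreconnected_convex_diff_of_countable countable_of_codiscrete)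

namespace Summit.HodgeConjecture.HodgeConjecture.Cruxes.H413.K2E1ScatteringFunctionalEquationCMTwo

variable (L : Type) [Field L] [NumberField L] [IsCMField L]
  [MeasurableSpace (quasiSplit (↥(maximalRealSubfield L)) L (IsCMField.complexConj L) 2).Adelic] [BorelSpace (quasiSplit (↥(maximalRealSubfield L)) L (IsCMField.complexConj L) 2).Adelic]

/-! ## §1 Per-ball identification of the coefficient: `cc = φ₀·c̃` on `U ∖ P` -/

/-- **THE COEFFICIENT OF A PER-BALL PACKAGE IS `φ₀·c̃` ON `U ∖ P`.**  Data: the structural measures; a per-ball package on `D_n = ball 0 (n+2)` at weight `n + 3` and level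
`0 < a` as exported by ★ X1∕★ F1 (`U` open, `⊆ D_n`, co-discrete in `D_n`; `cc` holomorphic on `U`; the Godement agreement of `vX` on `U ∩ {1 < Re}`; the `α`-system
`cnst_N(ι vX(z)) = φ₀•α₁(z) + cc(z)•α₂(z)` with `α₁ = [H^z]`, `α₂ = [H^{1−z}] ≠ 0`); and a pair `(P, c̃)` with ★ X2's clauses (`P` closed, co-discrete, `⊆ {Re ≤ 1}`; `c̃` analytic
off `P`, `= c` on `{1 < Re}`).  THEN `cc(z) = φ₀·c̃(z)` for every `z ∈ U ∖ P`: on `U ∩ {1 < Re}` by ★ X2a (S2) identified and `α₂ ≠ 0`; on `U ∖ P` (preconnected: `D_n` minus the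
countable `(D_n ∖ U) ∪ P`) by the identity theorem. [cite: BernsteinLapid2019, §4 Claims 4–5 (p. 10)] [cite: MoeglinWaldspurger1995, II.1.7, IV.1.9] -/
theorem coeff_eq_mul_of_package
    (μ : Measure (quasiSplit (↥(maximalRealSubfield L)) L (IsCMField.complexConj L) 2).automorphicQuotient) [(quasiSplit (↥(maximalRealSubfield L)) L (IsCMField.complexConj L) 2).IsAutomorphicMeasure μ]
    (νG : Measure (quasiSplit (↥(maximalRealSubfield L)) L (IsCMField.complexConj L) 2).Adelic) [νG.IsHaarMeasure] [νG.IsInvInvariant] [SFinite νG]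
    (ν : Measure ↥(adelicUnipotent (↥(maximalRealSubfield L)) L (IsCMField.complexConj L) 2)) [ν.IsHaarMeasure] [ν.IsMulRightInvariant] [ν.IsInvInvariant]
    {𝓕 : Set ↥(adelicUnipotent (↥(maximalRealSubfield L)) L (IsCMField.complexConj L) 2)}
    (h𝓕N : IsFundamentalDomain ↥(rationalUnipotent (↥(maximalRealSubfield L)) L (IsCMField.complexConj L) 2) 𝓕 ν) (h𝓕c : IsCompact (closure 𝓕)) (h𝓕₀ : ν 𝓕 ≠ 0)
    {β : (quasiSplit (↥(maximalRealSubfield L)) L (IsCMField.complexConj L) 2).Adelic → ℝ≥0∞}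
    (hβ : IsCoveringWeight ↥((arithmeticBorel (↥(maximalRealSubfield L)) L (IsCMField.complexConj L) 2).map (quasiSplit (↥(maximalRealSubfield L)) L (IsCMField.complexConj L) 2).arithmeticSubgroup.subtype) β)
    {μZ : Measure (borelQuotient (↥(maximalRealSubfield L)) L (IsCMField.complexConj L) 2)} [SFinite μZ]
    (hμZ : ∀ f : borelQuotient (↥(maximalRealSubfield L)) L (IsCMField.complexConj L) 2 → ℝ≥0∞, Measurable f → ∫⁻ z, f z ∂μZ = ∫⁻ g, β g * f (toBorelQuotient (↥(maximalRealSubfield L)) L (IsCMField.complexConj L) 2 g) ∂νG)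
    (φ₀ : ℂ) {n : ℕ} {a : ℝ≥0} (ha : 0 < a) {U : Set ℂ} {vX : ℂ → HX (↥(maximalRealSubfield L)) L (IsCMField.complexConj L) 2 (n + 3) μ} {cc : ℂ → ℂ}
    (hUo : IsOpen U) (hUD : U ⊆ Metric.ball (0 : ℂ) (n + 2)) (hUcd : ∀ z₀ ∈ Metric.ball (0 : ℂ) (n + 2), ∀ᶠ s in 𝓝[≠] z₀, s ∈ U) (hccd : DifferentiableOn ℂ cc U)
    (hgod : ∀ z ∈ U, 1 < z.re → ((vX z : HX (↥(maximalRealSubfield L)) L (IsCMField.complexConj L) 2 (n + 3) μ) : (quasiSplit (↥(maximalRealSubfield L)) L (IsCMField.complexConj L) 2).automorphicQuotient → ℂ) =ᵐ[(μ.withDensity fun x => (((supHeight (↥(maximalRealSubfield L)) L (IsCMField.complexConj L) 2 x)⁻¹ ^ (2 * (n + 3)) : ℝ≥0) : ℝ≥0∞))] (quasiSplit (↥(maximalRealSubfield L)) L (IsCMField.complexConj L) 2).quotFun (eisensteinSeriesU (flatSectionU (fun _ : (quasiSplit (↥(maximalRealSubfield L)) L (IsCMField.complexConj L) 2).Adelic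 => φ₀) z)))
    (hb : IotaBound (↥(maximalRealSubfield L)) L (IsCMField.complexConj L) 2 (n + 3) a μ μZ) {α₁ α₂ : ℂ → HN (↥(maximalRealSubfield L)) L (IsCMField.complexConj L) 2 (n + 3) a μZ}
    (hα₁ : ∀ z ∈ Metric.ball (0 : ℂ) (n + 2), (α₁ z : borelQuotient (↥(maximalRealSubfield L)) L (IsCMField.complexConj L) 2 → ℂ) =ᵐ[weightedTruncMeasure (↥(maximalRealSubfield L)) L (IsCMField.complexConj L) 2 (n + 3) a μZ] fun x => (((borelQuotHeight (↥(maximalRealSubfield L)) L (IsCMField.complexConj L) 2 x : ℝ≥0) : ℝ) : ℂ) ^ z)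
    (hα₂ : ∀ z ∈ Metric.ball (0 : ℂ) (n + 2), (α₂ z : borelQuotient (↥(maximalRealSubfield L)) L (IsCMField.complexConj L) 2 → ℂ) =ᵐ[weightedTruncMeasure (↥(maximalRealSubfield L)) L (IsCMField.complexConj L) 2 (n + 3) a μZ] fun x => (((borelQuotHeight (↥(maximalRealSubfield L)) L (IsCMField.complexConj L) 2 x : ℝ≥0) : ℝ) : ℂ) ^ (1 - z))
    (hα₂ne : ∀ z ∈ Metric.ball (0 : ℂ) (n + 2), α₂ z ≠ 0)
    (hsys : ∀ z ∈ U, cnstN (↥(maximalRealSubfield L)) L (IsCMField.complexConj L) 2 (n + 3) a μZ (iota hb (vX z)) = φ₀ • α₁ z + cc z • α₂ z)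
    {P : Set ℂ} {cI : ℂ → ℂ} (hPc : IsClosed P) (hPcd : ∀ z₀ : ℂ, ∀ᶠ s in 𝓝[≠] z₀, s ∉ P) (hPre : ∀ z ∈ P, z.re ≤ 1) (hcan : ∀ z : ℂ, z ∉ P → AnalyticAt ℂ cI z)
    (hcc : ∀ z : ℂ, 1 < z.re → cI z = ((((ν 𝓕).toReal⁻¹ : ℝ)) : ℂ) * (∫ v : ↥(adelicUnipotent (↥(maximalRealSubfield L)) L (IsCMField.complexConj L) 2), (((borelHeight ((quasiSplit (↥(maximalRealSubfield L)) L (IsCMField.complexConj L) 2).toAdelic (weylLongU ((IsCMField.complexConj L : L ≃ₐ[↥(maximalRealSubfield L)] L) : L →+* L) (rfl : (StdForm.antidiagonal 2).over L = (StdForm.antidiagonal 2).over L)) * (v : (quasiSplit (↥(maximalRealSubfield L)) L (IsCMField.complexConj L) 2).Adelic)) : ℝ) : ℂ) ^ z) ∂ν)) :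
    ∀ z ∈ U, z ∉ P → cc z = φ₀ * cI z := by
  classical
  -- involution facts, a non-zero trace-zero element of `L`, finiteness of `ν 𝓕`, the finite truncated measure at level `a`
  have hc : IsCMField.complexConj L * IsCMField.complexConj L = 1 :=
    AlgEquiv.ext fun x => by rw [AlgEquiv.mul_apply, AlgEquiv.one_apply, IsCMField.complexConj_apply_apply]
  have hc1 : IsCMField.complexConj L ≠ 1 := IsCMField.complexConj_ne_one L
  obtain ⟨δ, hcδ, hδ⟩ : ∃ δ : L, IsCMField.complexConj L δ = -δ ∧ δ ≠ 0 := by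
    obtain ⟨e, he⟩ : ∃ e : L, IsCMField.complexConj L e ≠ e := by
      by_contra h
      exact hc1 (AlgEquiv.ext fun x => not_ne_iff.mp (not_exists.mp h x))
    exact ⟨e - IsCMField.complexConj L e, by rw [map_sub, IsCMField.complexConj_apply_apply, neg_sub], sub_ne_zero.2 (Ne.symm he)⟩
  have h𝓕top : ν 𝓕 ≠ ∞ := ((measure_mono subset_closure).trans_lt h𝓕c.measure_lt_top).ne
  haveI : νG.IsMulRightInvariant := by rw [← Measure.inv_eq_self νG]; infer_instance
  haveI := isFiniteMeasure_weightedTruncMeasure_cm L μ νG hβ hμZ ha (n + 3)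
  -- the identification `zFun (H^w) = HZ^w` and the weight bound on the ball
  have hzF : ∀ w : ℂ, zFun (↥(maximalRealSubfield L)) L (IsCMField.complexConj L) 2 (fun g : (quasiSplit (↥(maximalRealSubfield L)) L (IsCMField.complexConj L) 2).Adelic => (((borelHeight g : ℝ)) : ℂ) ^ w) = fun x => (((borelQuotHeight (↥(maximalRealSubfield L)) L (IsCMField.complexConj L) 2 x : ℝ≥0) : ℝ) : ℂ) ^ w := by
    intro w
    funext x
    obtain ⟨g₁, rfl⟩ : ∃ g₁, toBorelQuotient (↥(maximalRealSubfield L)) L (IsCMField.complexConj L) 2 g₁ = x := Quotient.exists_rep x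
    refine zFun_toBorelQuotient (↥(maximalRealSubfield L)) L (IsCMField.complexConj L) 2 (fun γ hγ g' => ?_) g₁
    obtain ⟨γ₀, hγ₀, hγ₀B⟩ := exists_eq_toAdelic_of_mem_ratBorelSubgroup (↥(maximalRealSubfield L)) L (IsCMField.complexConj L) 2 hγ
    simp only [← hγ₀, borelHeight_rational_borel_mul γ₀ hγ₀B]
  have hzk : ∀ z ∈ Metric.ball (0 : ℂ) ((n : ℝ) + 2), z.re ≤ ((n + 3 : ℕ) : ℝ) := fun z hz => by
    have h1 : z.re ≤ ‖z‖ := Complex.re_le_norm z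
    have h2 : ‖z‖ < n + 2 := mem_ball_zero_iff.1 hz
    push_cast
    linarith
  -- ── Step 1: on the Godement part `U ∩ {1 < Re}`, `cc = φ₀·c` (★ X2a (S2) identified, `α₂ ≠ 0`) ──
  have hid : ∀ z ∈ U, 1 < z.re → cc z = φ₀ * ((((ν 𝓕).toReal⁻¹ : ℝ)) : ℂ) * (∫ v : ↥(adelicUnipotent (↥(maximalRealSubfield L)) L (IsCMField.complexConj L) 2), (((borelHeight ((quasiSplit (↥(maximalRealSubfield L)) L (IsCMField.complexConj L) 2).toAdelic (weylLongU ((IsCMField.complexConj L : L ≃ₐ[↥(maximalRealSubfield L)] L) : L →+* L) (rfl : (StdForm.antidiagonal 2).over L = (StdForm.antidiagonal 2).over L)) * (v : (quasiSplit (↥(maximalRealSubfield L)) L (IsCMField.complexConj L) 2).Adelic)) : ℝ) : ℂ) ^ z) ∂ν) := by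
    intro z hzU hz1
    have hzb := hUD hzU
    have hE : MemLp ((quasiSplit (↥(maximalRealSubfield L)) L (IsCMField.complexConj L) 2).quotFun (eisensteinSeriesU (flatSectionU (fun _ : (quasiSplit (↥(maximalRealSubfield L)) L (IsCMField.complexConj L) 2).Adelic => φ₀) z))) 2 (μ.withDensity fun x => (((supHeight (↥(maximalRealSubfield L)) L (IsCMField.complexConj L) 2 x)⁻¹ ^ (2 * (n + 3)) : ℝ≥0) : ℝ≥0∞)) :=
      eisensteinSeriesU_flatSectionU_memHX_cm_two L hcδ hδ ν h𝓕N h𝓕c μ φ₀ (n + 3) hz1 (hzk z hzb)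
    have hαF₁ : MemLp (zFun (↥(maximalRealSubfield L)) L (IsCMField.complexConj L) 2 (fun g : (quasiSplit (↥(maximalRealSubfield L)) L (IsCMField.complexConj L) 2).Adelic => (((borelHeight g : ℝ)) : ℂ) ^ z)) 2 (weightedTruncMeasure (↥(maximalRealSubfield L)) L (IsCMField.complexConj L) 2 (n + 3) a μZ) := by
      rw [hzF]; exact (Lp.memLp (α₁ z)).ae_eq (hα₁ z hzb)
    have hαF₂ : MemLp (zFun (↥(maximalRealSubfield L)) L (IsCMField.complexConj L) 2 (fun g : (quasiSplit (↥(maximalRealSubfield L)) L (IsCMField.complexConj L) 2).Adelic => (((borelHeight g : ℝ)) : ℂ) ^ (1 - z))) 2 (weightedTruncMeasure (↥(maximalRealSubfield L)) L (IsCMField.complexConj L) 2 (n + 3) a μZ) := by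
      rw [hzF]; exact (Lp.memLp (α₂ z)).ae_eq (hα₂ z hzb)
    have hS2 := cnstN_iota_toHX_eisensteinSeriesU_eq_smul_add_cm_two L ν h𝓕N h𝓕c hb
      (fun Φ hΦm hΦB hint hint' => integral_zFun_borelConstantTerm_eq_of_unfolding νG ν (fun _ hb₀ => map_conj_toAdelic_eq_self_two hc hc1 ν hb₀) h𝓕N h𝓕₀ h𝓕top hβ hμZ (n + 3) a hΦm hΦB hint hint')
      φ₀ hz1 hE hαF₁ hαF₂
    have hv : vX z = toHX (↥(maximalRealSubfield L)) L (IsCMField.complexConj L) 2 (n + 3) μ (eisensteinSeriesU (flatSectionU (fun _ : (quasiSplit (↥(maximalRealSubfield L)) L (IsCMField.complexConj L) 2).Adelic => φ₀) z)) hE :=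
      Lp.ext ((hgod z hzU hz1).trans (MemLp.coeFn_toLp _).symm)
    have h₁ : toHN (↥(maximalRealSubfield L)) L (IsCMField.complexConj L) 2 (n + 3) a μZ (fun g : (quasiSplit (↥(maximalRealSubfield L)) L (IsCMField.complexConj L) 2).Adelic => (((borelHeight g : ℝ)) : ℂ) ^ z) hαF₁ = α₁ z :=
      Lp.ext ((coeFn_toHN (↥(maximalRealSubfield L)) L (IsCMField.complexConj L) 2 (n + 3) a μZ _ hαF₁).trans (by rw [hzF]; exact (hα₁ z hzb).symm))
    have h₂ : toHN (↥(maximalRealSubfield L)) L (IsCMField.complexConj L) 2 (n + 3) a μZ (fun g : (quasiSplit (↥(maximalRealSubfield L)) L (IsCMField.complexConj L) 2).Adelic => (((borelHeight g : ℝ)) : ℂ) ^ (1 - z)) hαF₂ = α₂ z :=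
      Lp.ext ((coeFn_toHN (↥(maximalRealSubfield L)) L (IsCMField.complexConj L) 2 (n + 3) a μZ _ hαF₂).trans (by rw [hzF]; exact (hα₂ z hzb).symm))
    rw [← hv, h₁, h₂, hsys z hzU] at hS2
    have e2 : (cc z - φ₀ * ((((ν 𝓕).toReal⁻¹ : ℝ)) : ℂ) * (∫ v : ↥(adelicUnipotent (↥(maximalRealSubfield L)) L (IsCMField.complexConj L) 2), (((borelHeight ((quasiSplit (↥(maximalRealSubfield L)) L (IsCMField.complexConj L) 2).toAdelic (weylLongU ((IsCMField.complexConj L : L ≃ₐ[↥(maximalRealSubfield L)] L) : L →+* L) (rfl : (StdForm.antidiagonal 2).over L = (StdForm.antidiagonal 2).over L)) * (v : (quasiSplit (↥(maximalRealSubfield L)) L (IsCMField.complexConj L) 2).Adelic)) : ℝ) : ℂ) ^ z) ∂ν)) • α₂ z = 0 := by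
      rw [sub_smul, add_left_cancel hS2, sub_self]
    exact sub_eq_zero.1 ((smul_eq_zero.1 e2).resolve_right (hα₂ne z hzb))
  -- ── Step 2: the identity theorem on the preconnected open set `U ∖ P` ──
  have hA : AnalyticOnNhd ℂ cc (U \ P) := (hccd.mono fun _ hz => hz.1).analyticOnNhd (hUo.sdiff hPc)
  have hB : AnalyticOnNhd ℂ (fun z => φ₀ * cI z) (U \ P) := fun z hz => analyticAt_const.mul (hcan z hz.2)
  have hcount : (Metric.ball (0 : ℂ) (n + 2) \ U).Countable := by
    have hdisc : IsDiscrete (Metric.ball (0 : ℂ) (n + 2) \ U) := by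
      rw [isDiscrete_iff_nhdsNE]
      intro x hx
      rw [Filter.inf_principal_eq_bot]
      exact (hUcd x hx.1).mono fun _ hs hs' => hs'.2 hs
    exact (HereditarilyLindelofSpace.isLindelof _).countable_of_isDiscrete hdisc
  have hset : U \ P = Metric.ball (0 : ℂ) (n + 2) \ ((Metric.ball (0 : ℂ) (n + 2) \ U) ∪ P) := by
    ext z
    constructor
    · rintro ⟨hzU, hzP⟩
      exact ⟨hUD hzU, by rintro (⟨-, hzU'⟩ | hzP'); exacts [hzU' hzU, hzP hzP']⟩
    · rintro ⟨hzb, hz⟩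
      exact ⟨by_contra fun hzU => hz (Or.inl ⟨hzb, hzU⟩), fun hzP => hz (Or.inr hzP)⟩
  have hpre : IsPreconnected (U \ P) := by
    rw [hset]
    exact isPreconnected_convex_diff_of_countable Literature.Topology.Euclidean.one_lt_rank_real_complex (convex_ball (0 : ℂ) (n + 2)) Metric.isOpen_ball
      (hcount.union (countable_of_codiscrete hPcd))
  -- a base point `z₁ ∈ U` on the Godement part (co-discreteness of `U` at `3∕2 ∈ D_n`)
  obtain ⟨z₁, hz₁U, hz₁re⟩ : ∃ z₁ : ℂ, z₁ ∈ U ∧ 1 < z₁.re := by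
    have h32 : (((3 / 2 : ℝ)) : ℂ) ∈ Metric.ball (0 : ℂ) (n + 2) := by
      rw [mem_ball_zero_iff, Complex.norm_real, Real.norm_eq_abs, abs_of_pos (by norm_num : (0 : ℝ) < 3 / 2)]
      have h0 : (0 : ℝ) ≤ n := Nat.cast_nonneg n
      linarith
    have hre : ∀ᶠ s in 𝓝[≠] (((3 / 2 : ℝ)) : ℂ), 1 < s.re :=
      mem_nhdsWithin_of_mem_nhds ((isOpen_lt continuous_const Complex.continuous_re).mem_nhds
        (show (1 : ℝ) < ((((3 / 2 : ℝ)) : ℂ)).re by rw [Complex.ofReal_re]; norm_num))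
    exact ((hUcd _ h32).and hre).exists
  have hev : cc =ᶠ[𝓝 z₁] fun z => φ₀ * cI z := by
    filter_upwards [hUo.mem_nhds hz₁U, (isOpen_lt continuous_const Complex.continuous_re).mem_nhds hz₁re] with z hzU hz1
    rw [hid z hzU hz1, hcc z hz1]
    ring
  have hz₁P : z₁ ∉ P := fun h => by linarith [hPre z₁ h]
  have heq := hA.eqOn_of_preconnected_of_eventuallyEq hB hpre ⟨hz₁U, hz₁P⟩ hev
  exact fun z hzU hzP => heq ⟨hzU, hzP⟩

/-! ## §2 The per-ball functional equation `cc(z)·cc(1 − z) = 1` from UNIQUENESS (`φ₀ = 1`) -/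

/-- **`cc(z)·cc(1 − z) = 1` FOR `z, 1 − z` IN THE HOLOMORPHY SET, FROM THE BERNSTEIN–LAPID UNIQUENESS** (`φ₀ = 1`).  Data: left-`K`-invariant test functions `h_i ∈ C_c(G(𝔸))`,
the operators `T_i` with the eigen-equations `T_i vX(z) = ĥ_i(z)•vX(z)` on `U ⊆ D_n`, the `α`-system `cnst_N(ι vX(z)) = 1•α₁(z) + cc(z)•α₂(z)` (`α₁ = [H^z]`, `α₂ = [H^{1−z}] ≠ 0`
on `D_n`) and its UNIQUENESS on `U` (★ F1).  Since `ĥ_i(1 − z) = ĥ_i(z)` (★ (G1) `sphericalTransform_symm_cm_two`) and `α₁(1−z) = α₂(z)`, `α₂(1−z) = α₁(z)`, the vector `v′ = vX(1−z)`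
solves the `𝔛_z`-eigen-equations with `cnst_N(ι v′) = 1•α₂(z) + cc(1−z)•α₁(z)`: if `cc(1−z) = 0`, uniqueness applied to `vX(z) + v′` (`b = cc(z) + 1`) forces `v′ = 0`, so `α₂(z) = 0` ✗;
otherwise uniqueness applied to `cc(1−z)⁻¹•v′` (`b = cc(1−z)⁻¹`) gives `cc(1−z)⁻¹ = cc(z)`. [cite: BernsteinLapid2019, §5 and §4 Claim 3 (p. 9)] [cite: MoeglinWaldspurger1995, IV.1.10] -/
theorem coeff_mul_coeff_one_sub_eq_one_of_unique
    {μ : Measure (quasiSplit (↥(maximalRealSubfield L)) L (IsCMField.complexConj L) 2).automorphicQuotient}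
    (νG : Measure (quasiSplit (↥(maximalRealSubfield L)) L (IsCMField.complexConj L) 2).Adelic) [νG.IsHaarMeasure]
    {n : ℕ} {I : Type} {h : I → (quasiSplit (↥(maximalRealSubfield L)) L (IsCMField.complexConj L) 2).Adelic → ℂ}
    (hh : ∀ i, Continuous (h i)) (hhs : ∀ i, HasCompactSupport (h i))
    (hK : ∀ i, ∀ k₀ : (quasiSplit (↥(maximalRealSubfield L)) L (IsCMField.complexConj L) 2).Adelic, adelicVal (↥(maximalRealSubfield L)) L (IsCMField.complexConj L) 2 ((StdForm.antidiagonal 2).over L) k₀ ∈ standardMaximalCompactGL 2 L → ∀ x, h i (k₀ * x) = h i x)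
    {T : I → HX (↥(maximalRealSubfield L)) L (IsCMField.complexConj L) 2 (n + 3) μ →L[ℂ] HX (↥(maximalRealSubfield L)) L (IsCMField.complexConj L) 2 (n + 3) μ} {U : Set ℂ}
    (hUD : U ⊆ Metric.ball (0 : ℂ) (n + 2)) {vX : ℂ → HX (↥(maximalRealSubfield L)) L (IsCMField.complexConj L) 2 (n + 3) μ} {cc : ℂ → ℂ}
    (heig : ∀ z ∈ U, ∀ i, T i (vX z) = (∫ x, h i x * (((borelHeight x : ℝ≥0) : ℝ) : ℂ) ^ z ∂νG) • vX z)
    {a : ℝ≥0} {μZ : Measure (borelQuotient (↥(maximalRealSubfield L)) L (IsCMField.complexConj L) 2)}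
    (hb : IotaBound (↥(maximalRealSubfield L)) L (IsCMField.complexConj L) 2 (n + 3) a μ μZ) {α₁ α₂ : ℂ → HN (↥(maximalRealSubfield L)) L (IsCMField.complexConj L) 2 (n + 3) a μZ}
    (hα₁ : ∀ z ∈ Metric.ball (0 : ℂ) (n + 2), (α₁ z : borelQuotient (↥(maximalRealSubfield L)) L (IsCMField.complexConj L) 2 → ℂ) =ᵐ[weightedTruncMeasure (↥(maximalRealSubfield L)) L (IsCMField.complexConj L) 2 (n + 3) a μZ] fun x => (((borelQuotHeight (↥(maximalRealSubfield L)) L (IsCMField.complexConj L) 2 x : ℝ≥0) : ℝ) : ℂ) ^ z)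
    (hα₂ : ∀ z ∈ Metric.ball (0 : ℂ) (n + 2), (α₂ z : borelQuotient (↥(maximalRealSubfield L)) L (IsCMField.complexConj L) 2 → ℂ) =ᵐ[weightedTruncMeasure (↥(maximalRealSubfield L)) L (IsCMField.complexConj L) 2 (n + 3) a μZ] fun x => (((borelQuotHeight (↥(maximalRealSubfield L)) L (IsCMField.complexConj L) 2 x : ℝ≥0) : ℝ) : ℂ) ^ (1 - z))
    (hα₂ne : ∀ z ∈ Metric.ball (0 : ℂ) (n + 2), α₂ z ≠ 0)
    (hsys : ∀ z ∈ U, cnstN (↥(maximalRealSubfield L)) L (IsCMField.complexConj L) 2 (n + 3) a μZ (iota hb (vX z)) = (1 : ℂ) • α₁ z + cc z • α₂ z)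
    (huniq : ∀ z ∈ U, ∀ (ψ : HX (↥(maximalRealSubfield L)) L (IsCMField.complexConj L) 2 (n + 3) μ) (b : ℂ), (∀ i, T i ψ = (∫ x, h i x * (((borelHeight x : ℝ≥0) : ℝ) : ℂ) ^ z ∂νG) • ψ) →
      cnstN (↥(maximalRealSubfield L)) L (IsCMField.complexConj L) 2 (n + 3) a μZ (iota hb ψ) = (1 : ℂ) • α₁ z + b • α₂ z → ψ = vX z ∧ b = cc z) :
    ∀ z ∈ U, 1 - z ∈ U → cc z * cc (1 - z) = 1 := by
  intro z hz h1z
  have hzb := hUD hz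
  have h1zb := hUD h1z
  -- (G1) the symmetry of the spherical transforms, and the swap of the constant-term vectors under `z ↦ 1 − z`
  have hĥ : ∀ i, (∫ x, h i x * (((borelHeight x : ℝ≥0) : ℝ) : ℂ) ^ (1 - z) ∂νG) = ∫ x, h i x * (((borelHeight x : ℝ≥0) : ℝ) : ℂ) ^ z ∂νG := fun i =>
    (sphericalTransform_symm_cm_two L νG (hK i) (hh i) (hhs i) z).symm
  have hsw₁ : α₁ (1 - z) = α₂ z := Lp.ext ((hα₁ (1 - z) h1zb).trans (hα₂ z hzb).symm)
  have hsw₂ : α₂ (1 - z) = α₁ z := Lp.ext ((hα₂ (1 - z) h1zb).trans (by rw [sub_sub_cancel]; exact (hα₁ z hzb).symm))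
  -- `v′ = vX (1 − z)` solves the `𝔛_z`-eigen-equations, with constant term `1•α₂ z + cc(1−z)•α₁ z`
  have hv'T : ∀ i, T i (vX (1 - z)) = (∫ x, h i x * (((borelHeight x : ℝ≥0) : ℝ) : ℂ) ^ z ∂νG) • vX (1 - z) := fun i => by
    rw [heig (1 - z) h1z i, hĥ i]
  have hv'C : cnstN (↥(maximalRealSubfield L)) L (IsCMField.complexConj L) 2 (n + 3) a μZ (iota hb (vX (1 - z))) = (1 : ℂ) • α₂ z + cc (1 - z) • α₁ z := by
    rw [hsys (1 - z) h1z, hsw₁, hsw₂]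
  by_cases hc0 : cc (1 - z) = 0
  · -- `vX z + v′` solves the system with `b = cc z + 1`: uniqueness ⇒ `v′ = 0` ⇒ `α₂ z = 0`, absurd
    exfalso
    have hψT : ∀ i, T i (vX z + vX (1 - z)) = (∫ x, h i x * (((borelHeight x : ℝ≥0) : ℝ) : ℂ) ^ z ∂νG) • (vX z + vX (1 - z)) := fun i => by
      rw [map_add, heig z hz i, hv'T i, smul_add]
    have hψC : cnstN (↥(maximalRealSubfield L)) L (IsCMField.complexConj L) 2 (n + 3) a μZ (iota hb (vX z + vX (1 - z))) = (1 : ℂ) • α₁ z + (cc z + 1) • α₂ z := by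
      rw [map_add, map_add, hsys z hz, hv'C, hc0, zero_smul, add_zero, add_smul, add_assoc ((1 : ℂ) • α₁ z)]
    have h0 : vX (1 - z) = 0 := by
      have h := (huniq z hz _ _ hψT hψC).1
      simpa using h
    have h2 := hv'C
    rw [h0, map_zero, map_zero, hc0, zero_smul, add_zero, one_smul] at h2
    exact hα₂ne z hzb h2.symm
  · -- `cc(1−z)⁻¹ • v′` solves the system with `b = cc(1−z)⁻¹`: uniqueness ⇒ `cc(1−z)⁻¹ = cc z`
    have hψT : ∀ i, T i ((cc (1 - z))⁻¹ • vX (1 - z)) = (∫ x, h i x * (((borelHeight x : ℝ≥0) : ℝ) : ℂ) ^ z ∂νG) • ((cc (1 - z))⁻¹ • vX (1 - z)) := fun i => by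
      rw [map_smul, hv'T i, smul_smul, smul_smul, mul_comm (cc (1 - z))⁻¹]
    have hψC : cnstN (↥(maximalRealSubfield L)) L (IsCMField.complexConj L) 2 (n + 3) a μZ (iota hb ((cc (1 - z))⁻¹ • vX (1 - z))) = (1 : ℂ) • α₁ z + (cc (1 - z))⁻¹ • α₂ z := by
      rw [map_smul, map_smul, hv'C, smul_add, smul_smul, smul_smul, mul_one, inv_mul_cancel₀ hc0, add_comm ((cc (1 - z))⁻¹ • α₂ z) ((1 : ℂ) • α₁ z)]
    have h := (huniq z hz _ _ hψT hψC).2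
    rw [← h, inv_mul_cancel₀ hc0]

/-! ## §3 HEAD: the export head of ★ X2b with the functional equation (FE) -/

/-- **HEAD — THE GLOBAL BERNSTEIN–LAPID EXPORTS OF `U(1,1)_{L∕L⁺}` WITH THE FUNCTIONAL EQUATION OF THE SCATTERING COEFFICIENT** (module docstring): ★ X2b
`sphericalEisenstein_meromorphic_exports_cm_two`'s conclusion VERBATIM with, right after the (E3) constant-term link, the clause **(FE) `∀ z, z ∉ P → 1 − z ∉ P → cI z * cI (1 − z) = 1`**
on the SAME pole set `P` and coefficient `cI` — the letter `hFE` of ★ T2 `norm_eq_one_on_axis_of_fe`.  Proof: §1 (`φ₀ = 1`) on ★ F1's package of the ball `D₀ ∋ ½` against `(P, cI)`,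
§2 on that package, and the identity theorem for `z ↦ cI z·cI(1 − z)` on `ℂ ∖ (P ∪ (1 − P))` (open, preconnected: countable complement; a point `z₀` with `z₀, 1 − z₀ ∈ U ∖ P` exists by
co-discreteness at `½`). [cite: BernsteinLapid2019, Thm 2.3 and §5] [cite: MoeglinWaldspurger1995, IV.1.10–IV.1.11] [cite: Langlands1976, §7] -/
theorem sphericalEisenstein_meromorphic_exports_fe_cm_two
    -- structural letters: the measures (verbatim as FILE X1 ∕ ★ closer₂)
    (μ : Measure (quasiSplit (↥(maximalRealSubfield L)) L (IsCMField.complexConj L) 2).automorphicQuotient) [(quasiSplit (↥(maximalRealSubfield L)) L (IsCMField.complexConj L) 2).IsAutomorphicMeasure μ]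
    (νG : Measure (quasiSplit (↥(maximalRealSubfield L)) L (IsCMField.complexConj L) 2).Adelic) [νG.IsHaarMeasure] [νG.IsInvInvariant] [SFinite νG]
    (ν : Measure ↥(adelicUnipotent (↥(maximalRealSubfield L)) L (IsCMField.complexConj L) 2)) [ν.IsHaarMeasure] [ν.IsMulRightInvariant] [ν.IsInvInvariant]
    {𝓕 : Set ↥(adelicUnipotent (↥(maximalRealSubfield L)) L (IsCMField.complexConj L) 2)}
    (h𝓕N : IsFundamentalDomain ↥(rationalUnipotent (↥(maximalRealSubfield L)) L (IsCMField.complexConj L) 2) 𝓕 ν) (h𝓕c : IsCompact (closure 𝓕)) (h𝓕₀ : ν 𝓕 ≠ 0)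
    {β : (quasiSplit (↥(maximalRealSubfield L)) L (IsCMField.complexConj L) 2).Adelic → ℝ≥0∞}
    (hβ : IsCoveringWeight ↥((arithmeticBorel (↥(maximalRealSubfield L)) L (IsCMField.complexConj L) 2).map (quasiSplit (↥(maximalRealSubfield L)) L (IsCMField.complexConj L) 2).arithmeticSubgroup.subtype) β)
    {μZ : Measure (borelQuotient (↥(maximalRealSubfield L)) L (IsCMField.complexConj L) 2)} [SFinite μZ]
    (hμZ : ∀ f : borelQuotient (↥(maximalRealSubfield L)) L (IsCMField.complexConj L) 2 → ℝ≥0∞, Measurable f → ∫⁻ z, f z ∂μZ = ∫⁻ g, β g * f (toBorelQuotient (↥(maximalRealSubfield L)) L (IsCMField.complexConj L) 2 g) ∂νG)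
    (φ₀ : ℂ) :
    ∃ (Ec : ℂ → (quasiSplit (↥(maximalRealSubfield L)) L (IsCMField.complexConj L) 2).Adelic → ℂ) (P : Set ℂ) (cI : ℂ → ℂ)
      (I : ℕ → Type) (_ : ∀ n, Fintype (I n)) (η : (n : ℕ) → I n → GL (Fin 2) (AdeleRing (𝓞 L) L) → ℝ) (h : (n : ℕ) → I n → (quasiSplit (↥(maximalRealSubfield L)) L (IsCMField.complexConj L) 2).Adelic → ℂ)
      (a : ℕ → ℝ≥0) (κ : (n : ℕ) → I n → ℝ≥0) (T : (n : ℕ) → I n → HX (↥(maximalRealSubfield L)) L (IsCMField.complexConj L) 2 (n + 3) μ →L[ℂ] HX (↥(maximalRealSubfield L)) L (IsCMField.complexConj L) 2 (n + 3) μ) (U : ℕ → Set ℂ)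
      (vX : (n : ℕ) → ℂ → HX (↥(maximalRealSubfield L)) L (IsCMField.complexConj L) 2 (n + 3) μ) (cc : ℕ → ℂ → ℂ),
      -- GLOBAL: normal-form meromorphy, the Godement agreement, the pole set `P` (closed, co-discrete, inside `{Re ≤ 1}`, off `P` one is in the holomorphy sets)
      (∀ g, MeromorphicNFOn (fun z => Ec z g) univ) ∧ (∀ z : ℂ, 1 < z.re → Ec z = eisensteinSeriesU (flatSectionU (fun _ : (quasiSplit (↥(maximalRealSubfield L)) L (IsCMField.complexConj L) 2).Adelic => φ₀) z)) ∧
      IsClosed P ∧ (∀ z₀ : ℂ, ∀ᶠ s in 𝓝[≠] z₀, s ∉ P) ∧ (∀ z ∈ P, z.re ≤ 1) ∧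
      (∀ z : ℂ, z ∉ P → 1 < z.re ∨ (z ∈ U ⌈‖z‖⌉₊ ∧ z ∈ U (⌈‖z‖⌉₊ + 1))) ∧
      -- (E1) analytic off `P`; (E4) continuous in `g` off `P`; (E2) locally bounded near every `z₀ ∉ P`, uniformly on compacta in `g`
      (∀ g (z : ℂ), z ∉ P → AnalyticAt ℂ (fun z => Ec z g) z) ∧ (∀ z : ℂ, z ∉ P → Continuous (Ec z)) ∧
      (∀ z₀ : ℂ, z₀ ∉ P → ∀ K : Set (quasiSplit (↥(maximalRealSubfield L)) L (IsCMField.complexConj L) 2).Adelic, IsCompact K → ∃ V ∈ 𝓝 z₀, ∃ M : ℝ, ∀ z ∈ V, ∀ g ∈ K, ‖Ec z g‖ ≤ M) ∧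
      -- (E3) the constant-term coefficient `cI`: normal-form meromorphic on `ℂ`, analytic off `P`, `= c` on `{1 < Re}`, and the constant-term link there
      MeromorphicNFOn cI univ ∧ (∀ z : ℂ, z ∉ P → AnalyticAt ℂ cI z) ∧ (∀ z : ℂ, 1 < z.re → cI z = ((((ν 𝓕).toReal⁻¹ : ℝ)) : ℂ) * (∫ v : ↥(adelicUnipotent (↥(maximalRealSubfield L)) L (IsCMField.complexConj L) 2), (((borelHeight ((quasiSplit (↥(maximalRealSubfield L)) L (IsCMField.complexConj L) 2).toAdelic (weylLongU ((IsCMField.complexConj L : L ≃ₐ[↥(maximalRealSubfield L)] L) : L →+* L) (rfl : (StdForm.antidiagonal 2).over L = (StdForm.antidiagonal 2).over L)) * (v : (quasiSplit (↥(maximalRealSubfield L)) L (IsCMField.complexConj L) 2).Adelic)) : ℝ) : ℂ) ^ z) ∂ν)) ∧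
      (∀ z : ℂ, 1 < z.re → ∀ g : (quasiSplit (↥(maximalRealSubfield L)) L (IsCMField.complexConj L) 2).Adelic, borelConstantTerm ν 𝓕 (Ec z) g = φ₀ * (((borelHeight g : ℝ) : ℂ) ^ z + cI z * ((borelHeight g : ℝ) : ℂ) ^ (1 - z))) ∧
      -- (FE) THE FUNCTIONAL EQUATION of the constant-term coefficient off the pole set [BernsteinLapid2019, §5]
      (∀ z : ℂ, z ∉ P → 1 - z ∉ P → cI z * cI (1 - z) = 1) ∧
      -- PER BALL `D_n = ball 0 (n+2)` (weight `n + 3`): FILE X1's package ((R1), `h = S_η η`, regularity, cover, (R3), (R2), `U n`, `vX n`, `cc n`, Godement, eigen, `α`-system)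
      -- and (E5) THE POINTWISE REPRESENTATION of the global `Ec` in X1's integral currency at every `z ∈ U n ∖ P` with `ĥ_j(z) ≠ 0`
      ∀ n : ℕ,
        (∀ i, IsTestFunctionGL 2 L (η n i) ∧ (∀ g, 0 ≤ η n i g) ∧ (∀ g, η n i g⁻¹ = η n i g) ∧
          ∀ k₁ k₂ : (quasiSplit (↥(maximalRealSubfield L)) L (IsCMField.complexConj L) 2).Adelic, adelicVal (↥(maximalRealSubfield L)) L (IsCMField.complexConj L) 2 ((StdForm.antidiagonal 2).over L) k₁ ∈ standardMaximalCompactGL 2 L → adelicVal (↥(maximalRealSubfield L)) L (IsCMField.complexConj L) 2 ((StdForm.antidiagonal 2).over L) k₂ ∈ standardMaximalCompactGL 2 L →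
              ∀ x, η n i (adelicVal (↥(maximalRealSubfield L)) L (IsCMField.complexConj L) 2 ((StdForm.antidiagonal 2).over L) (k₁ * x * k₂)) = η n i (adelicVal (↥(maximalRealSubfield L)) L (IsCMField.complexConj L) 2 ((StdForm.antidiagonal 2).over L) x)) ∧
        (∀ i, h n i = fun y : (quasiSplit (↥(maximalRealSubfield L)) L (IsCMField.complexConj L) 2).Adelic => orbitalSmoothing νG (fun x : (quasiSplit (↥(maximalRealSubfield L)) L (IsCMField.complexConj L) 2).Adelic => ((η n i (adelicVal (↥(maximalRealSubfield L)) L (IsCMField.complexConj L) 2 ((StdForm.antidiagonal 2).over L) x) : ℝ) : ℂ)) (fun x : (quasiSplit (↥(maximalRealSubfield L)) L (IsCMField.complexConj L) 2).Adelic => ((η n i (adelicVal (↥(maximalRealSubfield L)) L (IsCMField.complexConj L) 2 ((StdForm.antidiagonal 2).over L) x) : ℝ) : ℂ)) y) ∧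
        (∀ i, Continuous (h n i) ∧ HasCompactSupport (h n i) ∧
          (∀ k₀ : (quasiSplit (↥(maximalRealSubfield L)) L (IsCMField.complexConj L) 2).Adelic, adelicVal (↥(maximalRealSubfield L)) L (IsCMField.complexConj L) 2 ((StdForm.antidiagonal 2).over L) k₀ ∈ standardMaximalCompactGL 2 L → ∀ x, h n i (k₀ * x) = h n i x) ∧
          (∀ g, h n i g⁻¹ = h n i g) ∧ (∀ g, conj (h n i g) = h n i g) ∧ (∀ g, 0 ≤ (h n i g).re)) ∧
        (∀ z ∈ Metric.ball (0 : ℂ) (n + 2), ∃ i, (∫ x, h n i x * (((borelHeight x : ℝ≥0) : ℝ) : ℂ) ^ z ∂νG) ≠ 0) ∧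
        0 < a n ∧ (∀ i, 1 ≤ κ n i) ∧
        (∀ i, ∀ z : borelQuotient (↥(maximalRealSubfield L)) L (IsCMField.complexConj L) 2, ∀ y ∈ tsupport (h n i), borelQuotHeight (↥(maximalRealSubfield L)) L (IsCMField.complexConj L) 2 z ≤ κ n i * borelQuotHeight (↥(maximalRealSubfield L)) L (IsCMField.complexConj L) 2 (rightShift (↥(maximalRealSubfield L)) L (IsCMField.complexConj L) 2 y z)) ∧
        (∀ i, ∀ u : HX (↥(maximalRealSubfield L)) L (IsCMField.complexConj L) 2 (n + 3) μ, (T n i u : (quasiSplit (↥(maximalRealSubfield L)) L (IsCMField.complexConj L) 2).automorphicQuotient → ℂ) =ᵐ[(μ.withDensity fun x => (((supHeight (↥(maximalRealSubfield L)) L (IsCMField.complexConj L) 2 x)⁻¹ ^ (2 * (n + 3)) : ℝ≥0) : ℝ≥0∞))]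
            fun ξ => ∫ y, h n i y * (u : (quasiSplit (↥(maximalRealSubfield L)) L (IsCMField.complexConj L) 2).automorphicQuotient → ℂ) (y⁻¹ • ξ) ∂νG) ∧
        IsOpen (U n) ∧ U n ⊆ Metric.ball (0 : ℂ) (n + 2) ∧ Metric.ball (0 : ℂ) (n + 2) ⊆ closure (U n) ∧ (∀ z₀ ∈ Metric.ball (0 : ℂ) (n + 2), ∀ᶠ s in 𝓝[≠] z₀, s ∈ U n) ∧
        DifferentiableOn ℂ (vX n) (U n) ∧ MeromorphicOn (vX n) (Metric.ball (0 : ℂ) (n + 2)) ∧ DifferentiableOn ℂ (cc n) (U n) ∧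
        (∀ z ∈ U n, 1 < z.re → ((vX n z : HX (↥(maximalRealSubfield L)) L (IsCMField.complexConj L) 2 (n + 3) μ) : (quasiSplit (↥(maximalRealSubfield L)) L (IsCMField.complexConj L) 2).automorphicQuotient → ℂ) =ᵐ[(μ.withDensity fun x => (((supHeight (↥(maximalRealSubfield L)) L (IsCMField.complexConj L) 2 x)⁻¹ ^ (2 * (n + 3)) : ℝ≥0) : ℝ≥0∞))] (quasiSplit (↥(maximalRealSubfield L)) L (IsCMField.complexConj L) 2).quotFun (eisensteinSeriesU (flatSectionU (fun _ : (quasiSplit (↥(maximalRealSubfield L)) L (IsCMField.complexConj L) 2).Adelic => φ₀) z))) ∧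
        (∀ z ∈ U n, ∀ i, T n i (vX n z) = (∫ x, h n i x * (((borelHeight x : ℝ≥0) : ℝ) : ℂ) ^ z ∂νG) • vX n z) ∧
        (∃ (hb : IotaBound (↥(maximalRealSubfield L)) L (IsCMField.complexConj L) 2 (n + 3) (a n) μ μZ) (α₁ α₂ : ℂ → HN (↥(maximalRealSubfield L)) L (IsCMField.complexConj L) 2 (n + 3) (a n) μZ),
          (∀ z ∈ Metric.ball (0 : ℂ) (n + 2), (α₁ z : borelQuotient (↥(maximalRealSubfield L)) L (IsCMField.complexConj L) 2 → ℂ) =ᵐ[weightedTruncMeasure (↥(maximalRealSubfield L)) L (IsCMField.complexConj L) 2 (n + 3) (a n) μZ] fun x => (((borelQuotHeight (↥(maximalRealSubfield L)) L (IsCMField.complexConj L) 2 x : ℝ≥0) : ℝ) : ℂ) ^ z) ∧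
          (∀ z ∈ Metric.ball (0 : ℂ) (n + 2), (α₂ z : borelQuotient (↥(maximalRealSubfield L)) L (IsCMField.complexConj L) 2 → ℂ) =ᵐ[weightedTruncMeasure (↥(maximalRealSubfield L)) L (IsCMField.complexConj L) 2 (n + 3) (a n) μZ] fun x => (((borelQuotHeight (↥(maximalRealSubfield L)) L (IsCMField.complexConj L) 2 x : ℝ≥0) : ℝ) : ℂ) ^ (1 - z)) ∧
          (∀ z ∈ Metric.ball (0 : ℂ) (n + 2), α₂ z ≠ 0) ∧
          ∀ z ∈ U n, cnstN (↥(maximalRealSubfield L)) L (IsCMField.complexConj L) 2 (n + 3) (a n) μZ (iota hb (vX n z)) = φ₀ • α₁ z + cc n z • α₂ z) ∧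
        (∀ j, ∀ z ∈ U n, z ∉ P → (∫ x, h n j x * (((borelHeight x : ℝ≥0) : ℝ) : ℂ) ^ z ∂νG) ≠ 0 →
          ∀ g : (quasiSplit (↥(maximalRealSubfield L)) L (IsCMField.complexConj L) 2).Adelic, Ec z g = (∫ x, h n j x * (((borelHeight x : ℝ≥0) : ℝ) : ℂ) ^ z ∂νG)⁻¹ * ∫ y, h n j y * ((vX n z : HX (↥(maximalRealSubfield L)) L (IsCMField.complexConj L) 2 (n + 3) μ) : (quasiSplit (↥(maximalRealSubfield L)) L (IsCMField.complexConj L) 2).automorphicQuotient → ℂ) ((quasiSplit (↥(maximalRealSubfield L)) L (IsCMField.complexConj L) 2).toAutomorphicQuotient (g * y)⁻¹) ∂νG) := by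
  -- ★ X2b's package
  obtain ⟨Ec, P, cI, I, hI, η, h, a, κ, T, U, vX, cc, hNF, hEcE, hPc, hPcd, hPre, hPU, hE1, hE4, hE2, hcNF, hcan, hcc, hE3, hballs⟩ :=
    sphericalEisenstein_meromorphic_exports_cm_two L μ νG ν h𝓕N h𝓕c h𝓕₀ hβ hμZ φ₀
  refine ⟨Ec, P, cI, I, hI, η, h, a, κ, T, U, vX, cc, hNF, hEcE, hPc, hPcd, hPre, hPU, hE1, hE4, hE2, hcNF, hcan, hcc, hE3, ?_, hballs⟩
  -- ★ F1's package at `φ₀ = 1` on the ball `D₀ = ball 0 2` (weight `3`), WITH uniqueness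
  obtain ⟨I₁, hI₁, η₁, h₁, a₁, κ₁, T₁, U₁, vX₁, cc₁, -, -, hreg₁, -, ha₁, -, -, -, hUo₁, hUD₁, -, hUcd₁, -, -, hccd₁, hgod₁, heig₁,
      ⟨hb₁, α₁', α₂', hα₁', hα₂', hα₂ne', hsys₁, huniq₁⟩, -⟩ := exists_ball_package_unique_cm_two L μ νG ν h𝓕N h𝓕c h𝓕₀ hβ hμZ 1 0
  -- §1: `cc₁ = 1·cI` on `U₁ ∖ P`; §2: `cc₁ z · cc₁ (1 − z) = 1` for `z, 1 − z ∈ U₁`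
  have hid : ∀ z ∈ U₁, z ∉ P → cc₁ z = 1 * cI z :=
    coeff_eq_mul_of_package L μ νG ν h𝓕N h𝓕c h𝓕₀ hβ hμZ 1 ha₁ hUo₁ hUD₁ hUcd₁ hccd₁ hgod₁ hb₁ hα₁' hα₂' hα₂ne' hsys₁ hPc hPcd hPre hcan hcc
  have hfe : ∀ z ∈ U₁, 1 - z ∈ U₁ → cc₁ z * cc₁ (1 - z) = 1 :=
    coeff_mul_coeff_one_sub_eq_one_of_unique L νG (fun i => (hreg₁ i).1) (fun i => (hreg₁ i).2.1) (fun i => (hreg₁ i).2.2.1) hUD₁ heig₁ hb₁ hα₁' hα₂' hα₂ne' hsys₁ huniq₁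
  -- §3: the identity theorem for `z ↦ cI z · cI (1 − z)` on `Ω = {z ∉ P, 1 − z ∉ P} = ℂ ∖ (P ∪ (1 − P))` (preconnected: countable complement)
  have hcount : (P ∪ (fun z : ℂ => 1 - z) ⁻¹' P).Countable := (countable_of_codiscrete hPcd).union ((countable_of_codiscrete hPcd).preimage sub_right_injective)
  have hΩpre : IsPreconnected (univ \ (P ∪ (fun z : ℂ => 1 - z) ⁻¹' P)) :=
    isPreconnected_convex_diff_of_countable Literature.Topology.Euclidean.one_lt_rank_real_complex convex_univ isOpen_univ hcount
  have hfan : AnalyticOnNhd ℂ (fun z => cI z * cI (1 - z)) (univ \ (P ∪ (fun z : ℂ => 1 - z) ⁻¹' P)) := fun z hz =>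
    (hcan z fun hzP => hz.2 (Or.inl hzP)).mul ((hcan (1 - z) fun h1zP => hz.2 (Or.inr h1zP)).comp (analyticAt_const.sub analyticAt_id))
  -- a point `z₀` with `z₀, 1 − z₀ ∈ U₁ ∖ P`: co-discreteness of `U₁` and of `P` at `½ ∈ D₀`, pulled back along the involution `s ↦ 1 − s` of `𝓝[≠] ½`
  have hhalf : (((1 / 2 : ℝ)) : ℂ) ∈ Metric.ball (0 : ℂ) ((0 : ℕ) + 2) := by
    rw [mem_ball_zero_iff, Complex.norm_real, Real.norm_eq_abs, abs_of_pos (by norm_num : (0 : ℝ) < 1 / 2)]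
    norm_num
  have htend : Tendsto (fun s : ℂ => 1 - s) (𝓝[≠] (((1 / 2 : ℝ)) : ℂ)) (𝓝[≠] (((1 / 2 : ℝ)) : ℂ)) := by
    refine tendsto_nhdsWithin_of_tendsto_nhds_of_eventually_within _ ?_ (eventually_nhdsWithin_of_forall fun s hs h1s => hs ?_)
    · have hc : Tendsto (fun s : ℂ => 1 - s) (𝓝 (((1 / 2 : ℝ)) : ℂ)) (𝓝 (1 - (((1 / 2 : ℝ)) : ℂ))) := ((continuous_const.sub continuous_id).tendsto _)
      have e : (1 : ℂ) - (((1 / 2 : ℝ)) : ℂ) = (((1 / 2 : ℝ)) : ℂ) := by push_cast; ring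
      rw [e] at hc
      exact hc.mono_left nhdsWithin_le_nhds
    · rw [mem_singleton_iff] at h1s ⊢
      rw [← sub_sub_cancel 1 s, h1s]
      push_cast; ring
  obtain ⟨z₀, ⟨hz₀U, hz₀P⟩, h1z₀U, h1z₀P⟩ : ∃ z₀ : ℂ, (z₀ ∈ U₁ ∧ z₀ ∉ P) ∧ (1 - z₀ ∈ U₁ ∧ 1 - z₀ ∉ P) :=
    (((hUcd₁ _ hhalf).and (hPcd _)).and (htend.eventually ((hUcd₁ _ hhalf).and (hPcd _)))).exists
  have hev : (fun z => cI z * cI (1 - z)) =ᶠ[𝓝 z₀] fun _ => (1 : ℂ) := by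
    have hc1 : ContinuousAt (fun z : ℂ => 1 - z) z₀ := (continuous_const.sub continuous_id).continuousAt
    filter_upwards [hUo₁.mem_nhds hz₀U, hPc.isOpen_compl.mem_nhds hz₀P, hc1.eventually_mem (hUo₁.mem_nhds h1z₀U),
      hc1.eventually_mem (hPc.isOpen_compl.mem_nhds h1z₀P)] with z hzU hzP h1U h1P
    rw [← one_mul (cI z), ← one_mul (cI (1 - z)), ← hid z hzU hzP, ← hid (1 - z) h1U h1P]
    exact hfe z hzU h1U
  have heq := hfan.eqOn_of_preconnected_of_eventuallyEq analyticOnNhd_const hΩpre ⟨mem_univ z₀, by rintro (h | h); exacts [hz₀P h, h1z₀P h]⟩ hev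
  exact fun z hzP h1zP => heq ⟨mem_univ z, by rintro (h | h); exacts [hzP h, h1zP h]⟩

end Summit.HodgeConjecture.HodgeConjecture.Cruxes.H413.K2E1ScatteringFunctionalEquationCMTwo

end
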